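import Summits.CriticalPhenomena.SAWScalingLimit.Theorems.SAWDevelopingMapNoFoldBoundInteriorSlit

/-!
# `NoFoldBound`, line Ideator3Sketch — interior vertices II: the modes through first arrivals

Crux `NoFoldBound` (stmt-CriticalPhenomena-8296), route `SAWDevelopingMap`. `interior_modes`: from
the port renewal identity (registered stub `stub_portRenewal`, hypothesis `hPR`) and slit simple
connectivity (`stub_slitSC`, hypothesis `hSSC`), at an interior vertex in the positive labelling
the sum mode is `S₀ + S₁ + S₂`, the Beltrami mode is `B₀ + ωB₁ + ω²B₂` (first-arrival sums of the
slit source modes) and the DCS mode vanishes.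
-/

noncomputable section

open scoped BigOperators
open Literature.Probability.LatticeModels Literature.Probability.RandomPlanarGeometry.SAW

namespace Summit.CriticalPhenomena.SAWScalingLimit.Theorems.SAWDevelopingMapNoFoldBound

/-! ## The interior core -/

/-- **Interior modes (positive labelling).** At a vertex `v` off the source mid-edge all of whose
neighbours lie in `Λ`, for the labelling `(w₀, w₁, w₂)` in the positive order (turn
`w₀ → v → w₁ = +π/3`): port renewal (`hPR`) and slit simple connectivity (`hSSC`) express the
three modes of the triple `(F{v,w₀}, F{v,w₁}, F{v,w₂})` through the first-arrival sums of the slit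
source triples — the sum mode is `S₀ + S₁ + S₂`, the Beltrami mode is `B₀ + ωB₁ + ω²B₂`
(`S_j = Σ_{γ∈FA_j} c_γ(α_T − √3xZ_γ)`, `B_j = Σ_{γ∈FA_j} c_γ(β_T + √3xZ_γ)`), and the DCS mode
vanishes (Lemma 1 at `v`, term by term). [folklore] -/
theorem interior_modes
    (hPR : ∀ (Λ : Finset HexVertex) (a : Sym2 HexVertex) (v w₀ w₁ w₂ : HexVertex), v ∈ Λ → v ∉ a →
      hexGraph.Adj v w₀ → hexGraph.Adj v w₁ → hexGraph.Adj v w₂ → w₀ ≠ w₁ → w₁ ≠ w₂ → w₀ ≠ w₂ →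
      ∀ (x σ : ℝ),
        hexParafermionicObservable Λ a x σ s(v, w₀) =
          (∑ γ : HexMidEdgeSAW Λ a s(v, w₀), if v ∉ γ.verts then
              γ.weight x σ * hexParafermionicObservable (Λ \ γ.verts.toFinset) s(w₀, v) x σ s(v, w₀)
            else 0) +
          (∑ γ : HexMidEdgeSAW Λ a s(v, w₁), if v ∉ γ.verts then
              γ.weight x σ * hexParafermionicObservable (Λ \ γ.verts.toFinset) s(w₁, v) x σ s(v, w₀)
            else 0) +
          (∑ γ : HexMidEdgeSAW Λ a s(v, w₂), if v ∉ γ.verts then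
              γ.weight x σ * hexParafermionicObservable (Λ \ γ.verts.toFinset) s(w₂, v) x σ s(v, w₀)
            else 0))
    (hSSC : ∀ (Λ : Finset HexVertex), hexDomainSimplyConnected Λ → ∀ a ∈ hexDomainBoundary Λ,
      ∀ (z : Sym2 HexVertex) (γ : HexMidEdgeSAW Λ a z), hexDomainSimplyConnected (Λ \ γ.verts.toFinset))
    {Λ : Finset HexVertex} (hΛ : hexDomainSimplyConnected Λ) {a : Sym2 HexVertex}
    (ha : a ∈ hexDomainBoundary Λ) {v : HexVertex} (hv : v ∈ Λ) (hva : v ∉ a)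
    {w₀ w₁ w₂ : HexVertex}
    (h₀ : hexGraph.Adj v w₀) (h₁ : hexGraph.Adj v w₁) (h₂ : hexGraph.Adj v w₂)
    (h₀₁ : w₀ ≠ w₁) (h₁₂ : w₁ ≠ w₂) (h₀₂ : w₀ ≠ w₂)
    (hchir : winding [hexMidpoint s(w₀, v), hexCenter v, hexMidpoint s(v, w₁)] = Real.pi / 3) :
    let F : Sym2 HexVertex → ℂ := hexParafermionicObservable Λ a hexCriticalFugacity (5 / 8)
    let ω : ℂ := Complex.exp (2 * Real.pi * Complex.I / 3)
    (F s(v, w₀) + F s(v, w₁) + F s(v, w₂) =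
      (∑ γ : HexMidEdgeSAW Λ a s(v, w₀), if v ∉ γ.verts then γ.weight hexCriticalFugacity (5 / 8) *
        (((1 + 2 * hexCriticalFugacity * Real.cos (5 * Real.pi / 24)) - Real.sqrt 3 * hexCriticalFugacity *
          ∑ δ : HexMidEdgeSAW ((Λ \ γ.verts.toFinset).erase v) s(v, w₁) s(v, w₂),
            hexCriticalFugacity ^ δ.length : ℝ) : ℂ) else 0) +
      (∑ γ : HexMidEdgeSAW Λ a s(v, w₁), if v ∉ γ.verts then γ.weight hexCriticalFugacity (5 / 8) *
        (((1 + 2 * hexCriticalFugacity * Real.cos (5 * Real.pi / 24)) - Real.sqrt 3 * hexCriticalFugacity *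
          ∑ δ : HexMidEdgeSAW ((Λ \ γ.verts.toFinset).erase v) s(v, w₂) s(v, w₀),
            hexCriticalFugacity ^ δ.length : ℝ) : ℂ) else 0) +
      (∑ γ : HexMidEdgeSAW Λ a s(v, w₂), if v ∉ γ.verts then γ.weight hexCriticalFugacity (5 / 8) *
        (((1 + 2 * hexCriticalFugacity * Real.cos (5 * Real.pi / 24)) - Real.sqrt 3 * hexCriticalFugacity *
          ∑ δ : HexMidEdgeSAW ((Λ \ γ.verts.toFinset).erase v) s(v, w₀) s(v, w₁),
            hexCriticalFugacity ^ δ.length : ℝ) : ℂ) else 0)) ∧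
    (F s(v, w₀) + ω * F s(v, w₁) + ω ^ 2 * F s(v, w₂) =
      (∑ γ : HexMidEdgeSAW Λ a s(v, w₀), if v ∉ γ.verts then γ.weight hexCriticalFugacity (5 / 8) *
        (((1 + 2 * hexCriticalFugacity * Real.cos (11 * Real.pi / 24)) + Real.sqrt 3 * hexCriticalFugacity *
          ∑ δ : HexMidEdgeSAW ((Λ \ γ.verts.toFinset).erase v) s(v, w₁) s(v, w₂),
            hexCriticalFugacity ^ δ.length : ℝ) : ℂ) else 0) +
      ω * (∑ γ : HexMidEdgeSAW Λ a s(v, w₁), if v ∉ γ.verts then γ.weight hexCriticalFugacity (5 / 8) *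
        (((1 + 2 * hexCriticalFugacity * Real.cos (11 * Real.pi / 24)) + Real.sqrt 3 * hexCriticalFugacity *
          ∑ δ : HexMidEdgeSAW ((Λ \ γ.verts.toFinset).erase v) s(v, w₂) s(v, w₀),
            hexCriticalFugacity ^ δ.length : ℝ) : ℂ) else 0) +
      ω ^ 2 * (∑ γ : HexMidEdgeSAW Λ a s(v, w₂), if v ∉ γ.verts then γ.weight hexCriticalFugacity (5 / 8) *
        (((1 + 2 * hexCriticalFugacity * Real.cos (11 * Real.pi / 24)) + Real.sqrt 3 * hexCriticalFugacity *
          ∑ δ : HexMidEdgeSAW ((Λ \ γ.verts.toFinset).erase v) s(v, w₀) s(v, w₁),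
            hexCriticalFugacity ^ δ.length : ℝ) : ℂ) else 0)) ∧
    F s(v, w₀) + ω * F s(v, w₂) + ω ^ 2 * F s(v, w₁) = 0 := by
  dsimp only
  -- all turns at `v` from the chirality
  obtain ⟨ε, hε, T01, T12, T20, T10, T21, T02⟩ := stub_localTurns v w₀ w₁ w₂ h₀ h₁ h₂ h₀₁ h₁₂ h₀₂
  have hε1 : ε = 1 := by
    rcases hε with h | h
    · exact h
    · exfalso
      rw [h] at T01
      have := Real.pi_pos
      linarith [T01.symm.trans hchir]
  subst hε1
  simp only [one_mul] at T01 T12 T20 T10 T21 T02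
  -- the slit source triples for the three entrances
  have V0 := fun (γ : HexMidEdgeSAW Λ a s(v, w₀)) (hγ : v ∉ γ.verts) =>
    slit_source_values hSSC hΛ ha hv hva h₀ h₁ h₂ h₀₁ h₀₂ h₁₂ T01 T02 γ hγ
  have V1 := fun (γ : HexMidEdgeSAW Λ a s(v, w₁)) (hγ : v ∉ γ.verts) =>
    slit_source_values hSSC hΛ ha hv hva h₁ h₂ h₀ h₁₂ h₀₁.symm h₀₂.symm T12 T10 γ hγ
  have V2 := fun (γ : HexMidEdgeSAW Λ a s(v, w₂)) (hγ : v ∉ γ.verts) =>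
    slit_source_values hSSC hΛ ha hv hva h₂ h₀ h₁ h₀₂.symm h₁₂.symm h₀₁ T20 T21 γ hγ
  -- port renewal at the three targets
  have R0 := hPR Λ a v w₀ w₁ w₂ hv hva h₀ h₁ h₂ h₀₁ h₁₂ h₀₂ hexCriticalFugacity (5 / 8)
  have R1 := hPR Λ a v w₁ w₂ w₀ hv hva h₁ h₂ h₀ h₁₂ h₀₂.symm h₀₁.symm hexCriticalFugacity (5 / 8)
  have R2 := hPR Λ a v w₂ w₀ w₁ hv hva h₂ h₀ h₁ h₀₂.symm h₀₁ h₁₂.symm hexCriticalFugacity (5 / 8)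
  -- abbreviations for the nine renewal sums
  set A00 := ∑ γ : HexMidEdgeSAW Λ a s(v, w₀), if v ∉ γ.verts then γ.weight hexCriticalFugacity (5 / 8) *
    hexParafermionicObservable (Λ \ γ.verts.toFinset) s(w₀, v) hexCriticalFugacity (5 / 8) s(v, w₀) else 0
    with hA00
  set A01 := ∑ γ : HexMidEdgeSAW Λ a s(v, w₀), if v ∉ γ.verts then γ.weight hexCriticalFugacity (5 / 8) *
    hexParafermionicObservable (Λ \ γ.verts.toFinset) s(w₀, v) hexCriticalFugacity (5 / 8) s(v, w₁) else 0
    with hA01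
  set A02 := ∑ γ : HexMidEdgeSAW Λ a s(v, w₀), if v ∉ γ.verts then γ.weight hexCriticalFugacity (5 / 8) *
    hexParafermionicObservable (Λ \ γ.verts.toFinset) s(w₀, v) hexCriticalFugacity (5 / 8) s(v, w₂) else 0
    with hA02
  set A10 := ∑ γ : HexMidEdgeSAW Λ a s(v, w₁), if v ∉ γ.verts then γ.weight hexCriticalFugacity (5 / 8) *
    hexParafermionicObservable (Λ \ γ.verts.toFinset) s(w₁, v) hexCriticalFugacity (5 / 8) s(v, w₀) else 0
    with hA10
  set A11 := ∑ γ : HexMidEdgeSAW Λ a s(v, w₁), if v ∉ γ.verts then γ.weight hexCriticalFugacity (5 / 8) *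
    hexParafermionicObservable (Λ \ γ.verts.toFinset) s(w₁, v) hexCriticalFugacity (5 / 8) s(v, w₁) else 0
    with hA11
  set A12 := ∑ γ : HexMidEdgeSAW Λ a s(v, w₁), if v ∉ γ.verts then γ.weight hexCriticalFugacity (5 / 8) *
    hexParafermionicObservable (Λ \ γ.verts.toFinset) s(w₁, v) hexCriticalFugacity (5 / 8) s(v, w₂) else 0
    with hA12
  set A20 := ∑ γ : HexMidEdgeSAW Λ a s(v, w₂), if v ∉ γ.verts then γ.weight hexCriticalFugacity (5 / 8) *
    hexParafermionicObservable (Λ \ γ.verts.toFinset) s(w₂, v) hexCriticalFugacity (5 / 8) s(v, w₀) else 0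
    with hA20
  set A21 := ∑ γ : HexMidEdgeSAW Λ a s(v, w₂), if v ∉ γ.verts then γ.weight hexCriticalFugacity (5 / 8) *
    hexParafermionicObservable (Λ \ γ.verts.toFinset) s(w₂, v) hexCriticalFugacity (5 / 8) s(v, w₁) else 0
    with hA21
  set A22 := ∑ γ : HexMidEdgeSAW Λ a s(v, w₂), if v ∉ γ.verts then γ.weight hexCriticalFugacity (5 / 8) *
    hexParafermionicObservable (Λ \ γ.verts.toFinset) s(w₂, v) hexCriticalFugacity (5 / 8) s(v, w₂) else 0
    with hA22
  -- the coherence sums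
  set α : ℝ := 1 + 2 * hexCriticalFugacity * Real.cos (5 * Real.pi / 24) with hα
  set β : ℝ := 1 + 2 * hexCriticalFugacity * Real.cos (11 * Real.pi / 24) with hβ
  set S0 := ∑ γ : HexMidEdgeSAW Λ a s(v, w₀), if v ∉ γ.verts then γ.weight hexCriticalFugacity (5 / 8) *
    ((α - Real.sqrt 3 * hexCriticalFugacity *
      ∑ δ : HexMidEdgeSAW ((Λ \ γ.verts.toFinset).erase v) s(v, w₁) s(v, w₂),
        hexCriticalFugacity ^ δ.length : ℝ) : ℂ) else 0 with hS0
  set S1 := ∑ γ : HexMidEdgeSAW Λ a s(v, w₁), if v ∉ γ.verts then γ.weight hexCriticalFugacity (5 / 8) *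
    ((α - Real.sqrt 3 * hexCriticalFugacity *
      ∑ δ : HexMidEdgeSAW ((Λ \ γ.verts.toFinset).erase v) s(v, w₂) s(v, w₀),
        hexCriticalFugacity ^ δ.length : ℝ) : ℂ) else 0 with hS1
  set S2 := ∑ γ : HexMidEdgeSAW Λ a s(v, w₂), if v ∉ γ.verts then γ.weight hexCriticalFugacity (5 / 8) *
    ((α - Real.sqrt 3 * hexCriticalFugacity *
      ∑ δ : HexMidEdgeSAW ((Λ \ γ.verts.toFinset).erase v) s(v, w₀) s(v, w₁),
        hexCriticalFugacity ^ δ.length : ℝ) : ℂ) else 0 with hS2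
  set B0 := ∑ γ : HexMidEdgeSAW Λ a s(v, w₀), if v ∉ γ.verts then γ.weight hexCriticalFugacity (5 / 8) *
    ((β + Real.sqrt 3 * hexCriticalFugacity *
      ∑ δ : HexMidEdgeSAW ((Λ \ γ.verts.toFinset).erase v) s(v, w₁) s(v, w₂),
        hexCriticalFugacity ^ δ.length : ℝ) : ℂ) else 0 with hB0
  set B1 := ∑ γ : HexMidEdgeSAW Λ a s(v, w₁), if v ∉ γ.verts then γ.weight hexCriticalFugacity (5 / 8) *
    ((β + Real.sqrt 3 * hexCriticalFugacity *
      ∑ δ : HexMidEdgeSAW ((Λ \ γ.verts.toFinset).erase v) s(v, w₂) s(v, w₀),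
        hexCriticalFugacity ^ δ.length : ℝ) : ℂ) else 0 with hB1
  set B2 := ∑ γ : HexMidEdgeSAW Λ a s(v, w₂), if v ∉ γ.verts then γ.weight hexCriticalFugacity (5 / 8) *
    ((β + Real.sqrt 3 * hexCriticalFugacity *
      ∑ δ : HexMidEdgeSAW ((Λ \ γ.verts.toFinset).erase v) s(v, w₀) s(v, w₁),
        hexCriticalFugacity ^ δ.length : ℝ) : ℂ) else 0 with hB2
  set ω : ℂ := Complex.exp (2 * Real.pi * Complex.I / 3) with hω
  have hω3 : ω ^ 3 = 1 := omega_pow_three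
  have hω1 : ‖ω‖ = 1 := norm_omega
  -- sum modes
  have eS0 : A00 + A01 + A02 = S0 := by
    rw [hA00, hA01, hA02, sum_ite_mul_add₃, hS0]
    refine Finset.sum_congr rfl fun γ _ => ?_
    by_cases hγ : v ∉ γ.verts
    · rw [if_pos hγ, if_pos hγ]
      obtain ⟨e0, e1, e2⟩ := V0 γ hγ
      rw [e0, e1, e2, source_sum_mode]
    · rw [if_neg hγ, if_neg hγ]
  have eS1 : A10 + A11 + A12 = S1 := by
    rw [hA10, hA11, hA12, sum_ite_mul_add₃, hS1]
    refine Finset.sum_congr rfl fun γ _ => ?_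
    by_cases hγ : v ∉ γ.verts
    · rw [if_pos hγ, if_pos hγ]
      obtain ⟨e0, e1, e2⟩ := V1 γ hγ
      rw [e0, e1, e2, ← source_sum_mode]
      ring
    · rw [if_neg hγ, if_neg hγ]
  have eS2 : A20 + A21 + A22 = S2 := by
    rw [hA20, hA21, hA22, sum_ite_mul_add₃, hS2]
    refine Finset.sum_congr rfl fun γ _ => ?_
    by_cases hγ : v ∉ γ.verts
    · rw [if_pos hγ, if_pos hγ]
      obtain ⟨e0, e1, e2⟩ := V2 γ hγ
      rw [e0, e1, e2, ← source_sum_mode]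
      ring
    · rw [if_neg hγ, if_neg hγ]
  -- Beltrami modes (positive labelling)
  have eB0 : A00 + ω * A01 + ω ^ 2 * A02 = B0 := by
    rw [hA00, hA01, hA02, sum_ite_mul_add₃', hB0]
    refine Finset.sum_congr rfl fun γ _ => ?_
    by_cases hγ : v ∉ γ.verts
    · rw [if_pos hγ, if_pos hγ]
      obtain ⟨e0, e1, e2⟩ := V0 γ hγ
      rw [e0, e1, e2, hω, source_belt_mode]
    · rw [if_neg hγ, if_neg hγ]
  have eB1 : A10 + ω * A11 + ω ^ 2 * A12 = ω * B1 := by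
    rw [hA10, hA11, hA12, sum_ite_mul_add₃', hB1, Finset.mul_sum]
    refine Finset.sum_congr rfl fun γ _ => ?_
    by_cases hγ : v ∉ γ.verts
    · rw [if_pos hγ, if_pos hγ]
      obtain ⟨e0, e1, e2⟩ := V1 γ hγ
      rw [e0, e1, e2]
      have hb := source_belt_mode
        (∑ δ : HexMidEdgeSAW ((Λ \ γ.verts.toFinset).erase v) s(v, w₂) s(v, w₀),
          hexCriticalFugacity ^ δ.length)
      rw [← hω] at hb
      linear_combination ω * γ.weight hexCriticalFugacity (5 / 8) * hb -
        (γ.weight hexCriticalFugacity (5 / 8) *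
          (↑hexCriticalFugacity * Complex.exp (-Complex.I * ↑(5 / 8 : ℝ) * ↑(-(Real.pi / 3) : ℝ)) +
            ↑hexCriticalFugacity * Complex.exp (-Complex.I * ↑(5 / 8 : ℝ) * ↑(4 * -(Real.pi / 3) : ℝ)) *
              ↑(∑ δ : HexMidEdgeSAW ((Λ \ γ.verts.toFinset).erase v) s(v, w₂) s(v, w₀),
                hexCriticalFugacity ^ δ.length))) * hω3
    · rw [if_neg hγ, if_neg hγ, mul_zero]
  have eB2 : A20 + ω * A21 + ω ^ 2 * A22 = ω ^ 2 * B2 := by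
    rw [hA20, hA21, hA22, sum_ite_mul_add₃', hB2, Finset.mul_sum]
    refine Finset.sum_congr rfl fun γ _ => ?_
    by_cases hγ : v ∉ γ.verts
    · rw [if_pos hγ, if_pos hγ]
      obtain ⟨e0, e1, e2⟩ := V2 γ hγ
      rw [e0, e1, e2]
      have hb := source_belt_mode
        (∑ δ : HexMidEdgeSAW ((Λ \ γ.verts.toFinset).erase v) s(v, w₀) s(v, w₁),
          hexCriticalFugacity ^ δ.length)
      rw [← hω] at hb
      linear_combination ω ^ 2 * γ.weight hexCriticalFugacity (5 / 8) * hb -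
        (γ.weight hexCriticalFugacity (5 / 8) *
          (↑hexCriticalFugacity * Complex.exp (-Complex.I * ↑(5 / 8 : ℝ) * ↑(Real.pi / 3 : ℝ)) +
            ↑hexCriticalFugacity * Complex.exp (-Complex.I * ↑(5 / 8 : ℝ) * ↑(4 * (Real.pi / 3) : ℝ)) *
              ↑(∑ δ : HexMidEdgeSAW ((Λ \ γ.verts.toFinset).erase v) s(v, w₀) s(v, w₁),
                hexCriticalFugacity ^ δ.length)) +
          ω * (γ.weight hexCriticalFugacity (5 / 8) *
          (↑hexCriticalFugacity * Complex.exp (-Complex.I * ↑(5 / 8 : ℝ) * ↑(-(Real.pi / 3) : ℝ)) +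
            ↑hexCriticalFugacity * Complex.exp (-Complex.I * ↑(5 / 8 : ℝ) * ↑(4 * -(Real.pi / 3) : ℝ)) *
              ↑(∑ δ : HexMidEdgeSAW ((Λ \ γ.verts.toFinset).erase v) s(v, w₀) s(v, w₁),
                hexCriticalFugacity ^ δ.length)))) * hω3
    · rw [if_neg hγ, if_neg hγ, mul_zero]
  -- DCS modes (negative labelling) vanish
  have eD0 : A00 + ω * A02 + ω ^ 2 * A01 = 0 := by
    rw [hA00, hA02, hA01, sum_ite_mul_add₃']
    refine Finset.sum_eq_zero fun γ _ => ?_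
    by_cases hγ : v ∉ γ.verts
    · rw [if_pos hγ]
      obtain ⟨e0, e1, e2⟩ := V0 γ hγ
      rw [e0, e1, e2, hω, source_dcs_mode, mul_zero]
    · rw [if_neg hγ]
  have eD1 : A10 + ω * A12 + ω ^ 2 * A11 = 0 := by
    rw [hA10, hA12, hA11, sum_ite_mul_add₃']
    refine Finset.sum_eq_zero fun γ _ => ?_
    by_cases hγ : v ∉ γ.verts
    · rw [if_pos hγ]
      obtain ⟨e0, e1, e2⟩ := V1 γ hγ
      rw [e0, e1, e2]
      have hd := source_dcs_mode
        (∑ δ : HexMidEdgeSAW ((Λ \ γ.verts.toFinset).erase v) s(v, w₂) s(v, w₀),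
          hexCriticalFugacity ^ δ.length)
      rw [← hω] at hd
      linear_combination ω ^ 2 * γ.weight hexCriticalFugacity (5 / 8) * hd -
        (γ.weight hexCriticalFugacity (5 / 8) *
          (↑hexCriticalFugacity * Complex.exp (-Complex.I * ↑(5 / 8 : ℝ) * ↑(-(Real.pi / 3) : ℝ)) +
            ↑hexCriticalFugacity * Complex.exp (-Complex.I * ↑(5 / 8 : ℝ) * ↑(4 * -(Real.pi / 3) : ℝ)) *
              ↑(∑ δ : HexMidEdgeSAW ((Λ \ γ.verts.toFinset).erase v) s(v, w₂) s(v, w₀),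
                hexCriticalFugacity ^ δ.length)) +
          ω * (γ.weight hexCriticalFugacity (5 / 8) *
          (↑hexCriticalFugacity * Complex.exp (-Complex.I * ↑(5 / 8 : ℝ) * ↑(Real.pi / 3 : ℝ)) +
            ↑hexCriticalFugacity * Complex.exp (-Complex.I * ↑(5 / 8 : ℝ) * ↑(4 * (Real.pi / 3) : ℝ)) *
              ↑(∑ δ : HexMidEdgeSAW ((Λ \ γ.verts.toFinset).erase v) s(v, w₂) s(v, w₀),
                hexCriticalFugacity ^ δ.length)))) * hω3
    · rw [if_neg hγ]
  have eD2 : A20 + ω * A22 + ω ^ 2 * A21 = 0 := by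
    rw [hA20, hA22, hA21, sum_ite_mul_add₃']
    refine Finset.sum_eq_zero fun γ _ => ?_
    by_cases hγ : v ∉ γ.verts
    · rw [if_pos hγ]
      obtain ⟨e0, e1, e2⟩ := V2 γ hγ
      rw [e0, e1, e2]
      have hd := source_dcs_mode
        (∑ δ : HexMidEdgeSAW ((Λ \ γ.verts.toFinset).erase v) s(v, w₀) s(v, w₁),
          hexCriticalFugacity ^ δ.length)
      rw [← hω] at hd
      linear_combination ω * γ.weight hexCriticalFugacity (5 / 8) * hd -
        (γ.weight hexCriticalFugacity (5 / 8) *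
          (↑hexCriticalFugacity * Complex.exp (-Complex.I * ↑(5 / 8 : ℝ) * ↑(Real.pi / 3 : ℝ)) +
            ↑hexCriticalFugacity * Complex.exp (-Complex.I * ↑(5 / 8 : ℝ) * ↑(4 * (Real.pi / 3) : ℝ)) *
              ↑(∑ δ : HexMidEdgeSAW ((Λ \ γ.verts.toFinset).erase v) s(v, w₀) s(v, w₁),
                hexCriticalFugacity ^ δ.length))) * hω3
    · rw [if_neg hγ]
  -- assemble
  rw [R0, R1, R2]
  refine ⟨?_, ?_, ?_⟩
  · rw [← eS0, ← eS1, ← eS2]; ring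
  · rw [← eB0]
    linear_combination eB1 + eB2
  · linear_combination eD0 + eD1 + eD2

end Summit.CriticalPhenomena.SAWScalingLimit.Theorems.SAWDevelopingMapNoFoldBound
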